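import Literature.LinearAlgebra.RootSystem.AffineWeylGroupLengthFormula
import HarnessLib

/-!
# Alcoves in the dominant chamber: `λ(wσ) = λ(σ) + n(w)` and Iwahori–Matsumoto's Corollaries 1.26–1.27

N. Iwahori, H. Matsumoto, *On some Bruhat decomposition and the structure of the Hecke rings of p-adic Chevalley groups*, Publ. Math. IHÉS
25 (1965) [IwahoriMatsumoto1965] (held `paper:doi-10-1007-bf02684396`), §1.9, PDF p. 19 (= p. 254): «**Corollary 1.26.** Let `d ∈ P`. Then
`Max_{w∈W} λ(w·T(d))` and `Min_{w∈W} λ(w·T(d))` are attained by unique elements `w^{(1)}`, `w^{(2)}` respectively. … We also have for any `w ∈ W`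
`λ(w w^{(1)} T(d)) = λ(w^{(1)} T(d)) - n(w)`, `λ(w w^{(2)} T(d)) = λ(w^{(2)} T(d)) + n(w)` …  **Corollary 1.27.** Let `σ ∈ DW`. Then `Min_{w∈W} λ(wσ)`
is attained by `w = 1` if and only if `σD∘` is contained in the positive Weyl chamber `{x ∈ 𝔥*; (α_i, x) > 0 for all i = 1, …, l}`. Also
`Max_{w∈W} λ(wσ)` is attained by `w = 1` if and only if `σD∘` is contained in the negative Weyl chamber `{x ∈ 𝔥*; (α_i, x) < 0 for all
i = 1, …, l}`. Proof. By Cor. 1.26, `λ(σ) = Min_{w∈W} λ(wσ)` is equivalent to `λ(w_iσ) > λ(σ)` (`i = 1, …, l`), i.e. to `P_i ∉ Λ(σ)` (`i = 1, …, l`);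
which is in turn equivalent to … the fact that `σD∘` is contained in the positive Weyl chamber. The second half is also proved similarly.» Here `λ(σ)` is the number of hyperplanes `P_{α,k}` separating `D∘` from `σD∘` (their Proposition 1.10: the word length on
`D'W = W_a`), `n(w)` the number of positive roots made negative by `w ∈ W`, and `P_i = P_{α_i,0} ∈ Λ(σ)` means that the wall `P_i` of `D∘`
separates `D∘` from `σD∘`.
J. E. Humphreys, *Reflection Groups and Coxeter Groups* (1990) [Humphreys1990], §4.4 Proposition (c) («`n(ws) = n(w) ± 1`») and §4.5 Theorem
(«`n(w) = ℓ(w)`»).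

THIS FILE (lane `lit-hodgefound`, prover seat p40, generation 45, row g45-#10; THEOREMS ONLY — no definition, instance, notation or named fact; net
debt 0) proves the two corollaries for an element `σ` of `Ŵ_a` (floor data) or of `W_a` (p13's word length in the `wallReflection`s), in the
CONVENTIONS of the `AffineWeylGroup*` files: weight space `M`, coroot levels, `A∘ = {0 < ⟨x, α^∨⟩ < 1 ∀ α ≻ 0} = alcove k∘`, `σA∘ = alcove k`,
`2λ(σ) = Σ_α |k_α - k∘_α|`; «`σD∘` lies in the positive Weyl chamber» reads `alcove k ⊆ {x | 0 < ⟨x, α_j^∨⟩ ∀ j ∈ Δ}`, equivalently `k_{α_j} ≥ 0`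
for `j ∈ Δ` (§1), and `wσ` for `w ∈ W` is `affineHom P g * σ`.

* §1 ★ `alcove_subset_setOf_pos_iff` ∕ `alcove_subset_setOf_neg_iff` (an alcove lies in the positive ∕ negative chamber iff its data is `≥ 0` ∕
  `≤ -1` on `Δ`), ★ `data_nonneg_of_forall_mem_support` ∕ `data_le_neg_one_of_forall_mem_support` (then on all positive roots).
* §2 ★★★ `sum_abs_data_affineHom_mul_eq_add` — COROLLARY 1.26, ADDITIVITY «`λ(wσ) = λ(σ) + n(w)`» for `σA∘` in the positive chamber and EVERY
  `w ∈ W` (in floor data on `Ŵ_a`; the pointwise identity `|k_α - k∘_{wα}| = |k_α - k∘_α| + |k∘_α - k∘_{wα}|`), ★★★ `sum_abs_data_affineHom_mul_eq_sub`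
  («`λ(wσ) = λ(σ) - n(w)`» for `σA∘` in the negative chamber); ★★★ `length_affineHom_mul_eq_add_of_forall_nonneg` ∕ `length_affineHom_mul_add_eq_of_forall_le`
  (the same for the Coxeter length on `W_a`: `ℓ(gσ) = ℓ(g) + ℓ(σ)`, resp. `ℓ(gσ) + ℓ(g) = ℓ(σ)`).
* §3 ★★ `length_reflection_mul_eq_succ_iff` («`λ(w_iσ) > λ(σ)` iff `P_i ∉ Λ(σ)`»: `ℓ(s_{α_j}σ) = ℓ(σ) + 1 ↔ k_{α_j} ≥ 0`, and `ℓ(s_{α_j}σ) + 1 = ℓ(σ)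
  ↔ k_{α_j} ≤ -1`), ★★★ `forall_length_le_length_affineHom_mul_iff` — COROLLARY 1.27: `Min_{g∈W} ℓ(gσ)` is attained at `g = 1` iff
  `k_{α_j} ≥ 0` for all `j ∈ Δ` (iff `σA∘` lies in the positive chamber), ★★★ `forall_length_affineHom_mul_le_length_iff` (the `Max`, negative
  chamber), ★★ `eq_one_of_length_affineHom_mul_eq` ∕ `eq_one_of_length_affineHom_mul_eq'` (uniqueness of the extremum in the coset `Wσ`:
  «attained by unique elements»).

BY NAME, nothing restated: rows g44-#6 (`alcove`, `image_affineHom_alcove`, `image_affineHom_reflection_alcove`, `fundamentalAlcove_eq_alcove`,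
`eq_of_mem_alcove_of_mem_alcove`, `floor_reflectionPerm_self_of_mem_alcove`), g44-#10 (`sum_abs_reflection_data_eq_ite`), g44-#2
(`smul_sum_filter_isPos_mem_fundamentalAlcove`), g45-#1 (`wallReflection`, `two_mul_length_affineWeylGroup_eq`, `isPreCoxeterSystem_affineWeylGroup`),
`WeylVector` (`coroot'_pos_of_isPos_of_forall_mem_support`), g44-#1 (`affineHom`, `affineHom_injective`).

## References

* [IwahoriMatsumoto1965] N. Iwahori, H. Matsumoto, Publ. Math. IHÉS 25 (1965) 5–48, §1.9 Corollaries 1.26, 1.27 (p. 254).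
* [Humphreys1990] J. E. Humphreys, *Reflection Groups and Coxeter Groups*, CUP (1990), §4.4 Proposition (c), §4.5 Theorem.
* [Bourbaki2002LieGroups46] N. Bourbaki, *Lie Groups and Lie Algebras, Chapters 4–6*, Ch. VI §2 (cite-only).
-/

noncomputable section

open Module Set Function
open Literature.GroupTheory.Coxeter Literature.GroupTheory.Coxeter.PreCoxeterSystem

namespace Literature.LinearAlgebra.RootSystem

namespace Base

variable {ι K M N : Type*} [Field K] [LinearOrder K] [IsStrictOrderedRing K] [AddCommGroup M] [Module K M]
  [AddCommGroup N] [Module K N] [Fintype ι] [DecidableEq ι]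
  {P : RootPairing ι K M N} [CharZero K] [P.IsCrystallographic] [P.IsReduced] (b : P.Base)

/-! ## §1 Alcoves in the positive (negative) Weyl chamber -/

section Chamber

omit [Fintype ι] [DecidableEq ι] [CharZero K] [P.IsCrystallographic] [P.IsReduced] in
/-- ★ A NONEMPTY alcove lies in the positive Weyl chamber `{x | 0 < ⟨x, α_j^∨⟩ ∀ j ∈ Δ}` iff its floor data is `≥ 0` on `Δ`.
[cite: IwahoriMatsumoto1965, §1.9 Corollary 1.27 ("σD∘ is contained in the positive Weyl chamber {x; (α_i, x) > 0 for all i = 1, …, l}")] -/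
theorem alcove_subset_setOf_pos_iff {k : ι → ℤ} (hne : (alcove P k).Nonempty) :
    alcove P k ⊆ {x : M | ∀ j ∈ b.support, 0 < P.coroot' j x} ↔ ∀ j ∈ b.support, 0 ≤ k j := by
  obtain ⟨x, hx⟩ := hne
  refine ⟨fun h j hj ↦ ?_, fun h y hy j hj ↦ ?_⟩
  · have h1 : (0 : K) < k j + 1 := (h hx j hj).trans (hx j).2
    have h2 : (0 : ℤ) < k j + 1 := by exact_mod_cast h1
    omega
  · have h1 : (0 : K) ≤ k j := by exact_mod_cast h j hj
    exact h1.trans_lt (hy j).1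

omit [Fintype ι] [DecidableEq ι] [CharZero K] [P.IsCrystallographic] [P.IsReduced] in
/-- ★ A NONEMPTY alcove lies in the negative Weyl chamber `{x | ⟨x, α_j^∨⟩ < 0 ∀ j ∈ Δ}` iff its floor data is `≤ -1` on `Δ`.
[cite: IwahoriMatsumoto1965, §1.9 Corollary 1.27 ("σD∘ is contained in the negative Weyl chamber {x; (α_i, x) < 0 for all i = 1, …, l}")] -/
theorem alcove_subset_setOf_neg_iff {k : ι → ℤ} (hne : (alcove P k).Nonempty) :
    alcove P k ⊆ {x : M | ∀ j ∈ b.support, P.coroot' j x < 0} ↔ ∀ j ∈ b.support, k j ≤ -1 := by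
  obtain ⟨x, hx⟩ := hne
  refine ⟨fun h j hj ↦ ?_, fun h y hy j hj ↦ ?_⟩
  · have h1 : ((k j : ℤ) : K) < 0 := (hx j).1.trans (h hx j hj)
    have h2 : k j < 0 := by exact_mod_cast h1
    omega
  · have h0 : k j + 1 ≤ 0 := by have := h j hj; omega
    have h1 : ((k j : ℤ) : K) + 1 ≤ 0 := by exact_mod_cast h0
    exact (hy j).2.trans_le h1

/-- ★ If the data of a nonempty alcove is `≥ 0` on `Δ`, it is `≥ 0` on every positive root (a positive coroot is a sum of simple coroots, so
`⟨x, α^∨⟩ > 0` on the alcove). [cite: IwahoriMatsumoto1965, §1.9 Corollary 1.27] [cite: Humphreys1990, §4.3 ("(λ, α) > 0 for all positive α")] -/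
theorem data_nonneg_of_forall_mem_support {k : ι → ℤ} {x : M} (hx : x ∈ alcove P k) (hdom : ∀ j ∈ b.support, 0 ≤ k j) {i : ι}
    (hi : b.IsPos i) : 0 ≤ k i := by
  have hpos : ∀ j ∈ b.support, 0 < P.coroot' j x := fun j hj ↦ by
    have h1 : (0 : K) ≤ k j := by exact_mod_cast hdom j hj
    exact h1.trans_lt (hx j).1
  have h1 : (0 : K) < k i + 1 := (coroot'_pos_of_isPos_of_forall_mem_support b hpos hi).trans (hx i).2
  have h2 : (0 : ℤ) < k i + 1 := by exact_mod_cast h1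
  omega

/-- ★ Dually: data `≤ -1` on `Δ` forces data `≤ -1` on every positive root (apply the previous statement to the alcove `-alcove k`, whose data is
`α ↦ -k_α - 1`). [cite: IwahoriMatsumoto1965, §1.9 Corollary 1.27] -/
theorem data_le_neg_one_of_forall_mem_support {k : ι → ℤ} {x : M} (hx : x ∈ alcove P k) (hneg : ∀ j ∈ b.support, k j ≤ -1) {i : ι}
    (hi : b.IsPos i) : k i ≤ -1 := by
  have hx' : -x ∈ alcove P (fun i ↦ -k i - 1) := fun l ↦ by
    obtain ⟨h1, h2⟩ := hx l
    simp only [map_neg, Int.cast_sub, Int.cast_neg, Int.cast_one]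
    constructor <;> linarith
  have h := data_nonneg_of_forall_mem_support b hx' (fun j hj ↦ by have := hneg j hj; omega) hi
  omega

end Chamber

/-! ## §2 Corollary 1.26: `λ(wσ) = λ(σ) ± n(w)` -/

section Additivity

/-- `|a - e'| = |a - e| + |e - e'|` for `e, e' ∈ {0, -1}` and `a` on the far side of `e` (`a ≥ 0` if `e = 0`, `a ≤ -1` if `e = -1`). [folklore] -/
private theorem abs_sub_eq_abs_sub_add_abs_sub {a e e' : ℤ} (he : e = 0 ∨ e = -1) (he' : e' = 0 ∨ e' = -1) (h0 : e = 0 → 0 ≤ a)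
    (h1 : e = -1 → a ≤ -1) : |a - e'| = |a - e| + |e - e'| := by
  rcases he with rfl | rfl <;> rcases he' with rfl | rfl
  · simp
  · have ha := h0 rfl
    rw [abs_of_nonneg (by omega), abs_of_nonneg (by omega), abs_of_nonneg (by norm_num)]; ring
  · have ha := h1 rfl
    rw [abs_of_nonpos (by omega), abs_of_nonpos (by omega), abs_of_nonpos (by norm_num)]; ring
  · simp

/-- `|a - e'| = |a - e| - |e - e'|` for `e, e' ∈ {0, -1}` and `a` on the near side of `e` (`a ≤ -1` if `e = 0`, `a ≥ 0` if `e = -1`). [folklore] -/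
private theorem abs_sub_eq_abs_sub_sub_abs_sub {a e e' : ℤ} (he : e = 0 ∨ e = -1) (he' : e' = 0 ∨ e' = -1) (h0 : e = 0 → a ≤ -1)
    (h1 : e = -1 → 0 ≤ a) : |a - e'| = |a - e| - |e - e'| := by
  rcases he with rfl | rfl <;> rcases he' with rfl | rfl
  · simp
  · have ha := h0 rfl
    rw [abs_of_nonpos (by omega), abs_of_nonpos (by omega), abs_of_nonneg (by norm_num)]; ring
  · have ha := h1 rfl
    rw [abs_of_nonneg (by omega), abs_of_nonneg (by omega), abs_of_nonpos (by norm_num)]; ring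
  · simp

omit [LinearOrder K] [IsStrictOrderedRing K] [Fintype ι] [DecidableEq ι] [P.IsCrystallographic] [P.IsReduced] in
/-- The value `k∘_α ∈ {0, -1}`. [folklore] -/
private theorem ite_eq_zero_or_eq_neg_one [DecidablePred b.IsPos] (i : ι) :
    (if b.IsPos i then (0 : ℤ) else -1) = 0 ∨ (if b.IsPos i then (0 : ℤ) else -1) = -1 := by
  by_cases hi : b.IsPos i
  · exact Or.inl (if_pos hi)
  · exact Or.inr (if_neg hi)

omit [LinearOrder K] [IsStrictOrderedRing K] [DecidableEq ι] [CharZero K] [P.IsCrystallographic] [P.IsReduced] in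
/-- Re-indexing by `α ↦ wα`: `Σ_α F(k_{w⁻¹α}, α) = Σ_α F(k_α, wα)`. [folklore] -/
private theorem sum_comp_inv_smul_eq (g : P.Aut) (F : ι → ι → ℤ) :
    ∑ i, F (g⁻¹ • i) i = ∑ i, F i (g • i) :=
  (Fintype.sum_equiv (MulAction.toPerm g) (fun i ↦ F i (g • i)) (fun i ↦ F (g⁻¹ • i) i)
    (fun i ↦ by rw [MulAction.toPerm_apply, inv_smul_smul])).symm

omit [LinearOrder K] [IsStrictOrderedRing K] [DecidableEq ι] [P.IsCrystallographic] [P.IsReduced] in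
/-- ★★ **THE COUNT FOR `w·alcove k` WHEN `alcove k` LIES IN THE POSITIVE CHAMBER** (floor-data form of «`λ(wσ) = λ(σ) + n(w)`»): for data `k`
with `k_{-α} = -k_α - 1` and `k_α ≥ 0` for `α ≻ 0`, and any automorphism `w` of `P`,
`Σ_α |k_{w⁻¹α} - k∘_α| = Σ_α |k_α - k∘_α| + Σ_α |k∘_{w⁻¹α} - k∘_α|` — pointwise, `|k_α - k∘_{wα}| = |k_α - k∘_α| + |k∘_α - k∘_{wα}|`.
[cite: IwahoriMatsumoto1965, §1.9 Corollary 1.26 ("λ(w w⁽²⁾T(d)) = λ(w⁽²⁾T(d)) + n(w)")] -/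
theorem sum_abs_data_comp_eq_add [DecidablePred b.IsPos] {k : ι → ℤ} (hsymm : ∀ i, k (P.reflectionPerm i i) = -k i - 1)
    (hdom : ∀ i, b.IsPos i → 0 ≤ k i) (g : P.Aut) :
    ∑ i, |k (g⁻¹ • i) - (if b.IsPos i then (0 : ℤ) else -1)| =
      ∑ i, |k i - (if b.IsPos i then (0 : ℤ) else -1)| + ∑ i, |(if b.IsPos (g⁻¹ • i) then (0 : ℤ) else -1) - (if b.IsPos i then (0 : ℤ) else -1)| := by
  letI := P.indexNeg
  rw [sum_comp_inv_smul_eq g (fun j i ↦ |k j - (if b.IsPos i then (0 : ℤ) else -1)|),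
    sum_comp_inv_smul_eq g (fun j i ↦ |(if b.IsPos j then (0 : ℤ) else -1) - (if b.IsPos i then (0 : ℤ) else -1)|),
    ← Finset.sum_add_distrib]
  refine Finset.sum_congr rfl fun i _ ↦ abs_sub_eq_abs_sub_add_abs_sub (ite_eq_zero_or_eq_neg_one b i)
    (ite_eq_zero_or_eq_neg_one b (g • i)) (fun h ↦ hdom i ?_) (fun h ↦ ?_)
  · by_contra hi; rw [if_neg hi] at h; exact absurd h (by norm_num)
  · have hi : ¬ b.IsPos i := fun hi ↦ by rw [if_pos hi] at h; exact absurd h (by norm_num)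
    have h1 : b.IsPos (-i) := (RootPairing.Base.IsPos.or_neg b i).resolve_left hi
    have h2 := hdom (-i) h1
    have h3 : k (-i) = -k i - 1 := hsymm i
    omega

omit [LinearOrder K] [IsStrictOrderedRing K] [DecidableEq ι] [P.IsCrystallographic] [P.IsReduced] in
/-- ★★ **THE COUNT FOR `w·alcove k` WHEN `alcove k` LIES IN THE NEGATIVE CHAMBER** («`λ(wσ) = λ(σ) - n(w)`»): for data `k` with
`k_{-α} = -k_α - 1` and `k_α ≤ -1` for `α ≻ 0`, `Σ_α |k_{w⁻¹α} - k∘_α| = Σ_α |k_α - k∘_α| - Σ_α |k∘_{w⁻¹α} - k∘_α|`.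
[cite: IwahoriMatsumoto1965, §1.9 Corollary 1.26 ("λ(w w⁽¹⁾T(d)) = λ(w⁽¹⁾T(d)) − n(w)")] -/
theorem sum_abs_data_comp_eq_sub [DecidablePred b.IsPos] {k : ι → ℤ} (hsymm : ∀ i, k (P.reflectionPerm i i) = -k i - 1)
    (hneg : ∀ i, b.IsPos i → k i ≤ -1) (g : P.Aut) :
    ∑ i, |k (g⁻¹ • i) - (if b.IsPos i then (0 : ℤ) else -1)| =
      ∑ i, |k i - (if b.IsPos i then (0 : ℤ) else -1)| - ∑ i, |(if b.IsPos (g⁻¹ • i) then (0 : ℤ) else -1) - (if b.IsPos i then (0 : ℤ) else -1)| := by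
  letI := P.indexNeg
  rw [sum_comp_inv_smul_eq g (fun j i ↦ |k j - (if b.IsPos i then (0 : ℤ) else -1)|),
    sum_comp_inv_smul_eq g (fun j i ↦ |(if b.IsPos j then (0 : ℤ) else -1) - (if b.IsPos i then (0 : ℤ) else -1)|),
    ← Finset.sum_sub_distrib]
  refine Finset.sum_congr rfl fun i _ ↦ abs_sub_eq_abs_sub_sub_abs_sub (ite_eq_zero_or_eq_neg_one b i)
    (ite_eq_zero_or_eq_neg_one b (g • i)) (fun h ↦ hneg i ?_) (fun h ↦ ?_)
  · by_contra hi; rw [if_neg hi] at h; exact absurd h (by norm_num)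
  · have hi : ¬ b.IsPos i := fun hi ↦ by rw [if_pos hi] at h; exact absurd h (by norm_num)
    have h1 : b.IsPos (-i) := (RootPairing.Base.IsPos.or_neg b i).resolve_left hi
    have h2 := hneg (-i) h1
    have h3 : k (-i) = -k i - 1 := hsymm i
    omega

/-- Bookkeeping shared by the two chambers: a point of `σA∘ = alcove k`, the forced values `k_{-α} = -k_α - 1`, and the data of `wσA∘` and `wA∘`
as `k ∘ w⁻¹` and `k∘ ∘ w⁻¹`. [cite: Humphreys1990, §4.3 ("Ŵ_a does permute 𝓐")] -/
private theorem data_affineHom_mul_eq [Nonempty ι] [DecidablePred b.IsPos] {η : ι}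
    (hη : ∀ k, P.coroot η - P.coroot k ∈ AddSubmonoid.closure (P.coroot '' (b.support : Set ι))) {w : M ≃ᵃ[K] M} {k : ι → ℤ}
    (hk : w '' {x : M | ∀ i, b.IsPos i → 0 < P.coroot' i x ∧ P.coroot' i x < 1} = alcove P k) (g : P.Aut) {k' kg : ι → ℤ}
    (hk' : ⇑(affineHom P g * w) '' {x : M | ∀ i, b.IsPos i → 0 < P.coroot' i x ∧ P.coroot' i x < 1} = alcove P k')
    (hkg : affineHom P g '' {x : M | ∀ i, b.IsPos i → 0 < P.coroot' i x ∧ P.coroot' i x < 1} = alcove P kg) :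
    (∃ y, y ∈ alcove P k) ∧ (∀ i, k (P.reflectionPerm i i) = -k i - 1) ∧ (k' = fun i ↦ k (g⁻¹ • i)) ∧
      kg = fun i ↦ (if b.IsPos (g⁻¹ • i) then (0 : ℤ) else -1) := by
  obtain ⟨x₀, hx₀⟩ : {x : M | ∀ i, b.IsPos i → 0 < P.coroot' i x ∧ P.coroot' i x < 1}.Nonempty :=
    ⟨_, smul_sum_filter_isPos_mem_fundamentalAlcove b hη⟩
  have hy : w x₀ ∈ alcove P k := hk ▸ mem_image_of_mem _ hx₀
  have h1 : ⇑(affineHom P g * w) '' {x : M | ∀ i, b.IsPos i → 0 < P.coroot' i x ∧ P.coroot' i x < 1} = alcove P (fun i ↦ k (g⁻¹ • i)) := by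
    rw [AffineEquiv.coe_mul, image_comp, hk, image_affineHom_alcove]
  have h2 : affineHom P g '' {x : M | ∀ i, b.IsPos i → 0 < P.coroot' i x ∧ P.coroot' i x < 1} =
      alcove P (fun i ↦ if b.IsPos (g⁻¹ • i) then (0 : ℤ) else -1) := by
    rw [fundamentalAlcove_eq_alcove b, image_affineHom_alcove]
  have hz : (affineHom P g * w) x₀ ∈ alcove P k' := hk' ▸ mem_image_of_mem _ hx₀
  have hz' : (affineHom P g * w) x₀ ∈ alcove P (fun i ↦ k (g⁻¹ • i)) := h1 ▸ mem_image_of_mem _ hx₀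
  have hu : affineHom P g x₀ ∈ alcove P kg := hkg ▸ mem_image_of_mem _ hx₀
  have hu' : affineHom P g x₀ ∈ alcove P (fun i ↦ if b.IsPos (g⁻¹ • i) then (0 : ℤ) else -1) := h2 ▸ mem_image_of_mem _ hx₀
  exact ⟨⟨_, hy⟩, fun i ↦ floor_reflectionPerm_self_of_mem_alcove hy i, eq_of_mem_alcove_of_mem_alcove hz hz',
    eq_of_mem_alcove_of_mem_alcove hu hu'⟩

/-- ★★★ **IWAHORI–MATSUMOTO COROLLARY 1.26 ∕ 1.27, ADDITIVITY: «`λ(wσ) = λ(σ) + n(w)`» WHEN `σA∘` LIES IN THE POSITIVE WEYL CHAMBER** — in floor data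
on `Ŵ_a`: if `σA∘ = alcove k` with `k_{α_j} ≥ 0` for `j ∈ Δ`, then for every automorphism `w` of `P` (in particular every `w ∈ W`), with
`wσA∘ = alcove k'` and `wA∘ = alcove k^w`: `Σ|k' - k∘| = Σ|k - k∘| + Σ|k^w - k∘|` (twice: `λ(wσ) = λ(σ) + n(w)`).
[cite: IwahoriMatsumoto1965, §1.9 Corollary 1.26 ("λ(w w⁽²⁾T(d)) = λ(w⁽²⁾T(d)) + n(w)") and Corollary 1.27] -/
theorem sum_abs_data_affineHom_mul_eq_add [Nonempty ι] [DecidablePred b.IsPos] {η : ι}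
    (hη : ∀ k, P.coroot η - P.coroot k ∈ AddSubmonoid.closure (P.coroot '' (b.support : Set ι))) {w : M ≃ᵃ[K] M} {k : ι → ℤ}
    (hk : w '' {x : M | ∀ i, b.IsPos i → 0 < P.coroot' i x ∧ P.coroot' i x < 1} = alcove P k) (hdom : ∀ j ∈ b.support, 0 ≤ k j)
    (g : P.Aut) {k' kg : ι → ℤ}
    (hk' : ⇑(affineHom P g * w) '' {x : M | ∀ i, b.IsPos i → 0 < P.coroot' i x ∧ P.coroot' i x < 1} = alcove P k')
    (hkg : affineHom P g '' {x : M | ∀ i, b.IsPos i → 0 < P.coroot' i x ∧ P.coroot' i x < 1} = alcove P kg) :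
    ∑ i, |k' i - (if b.IsPos i then (0 : ℤ) else -1)| =
      ∑ i, |k i - (if b.IsPos i then (0 : ℤ) else -1)| + ∑ i, |kg i - (if b.IsPos i then (0 : ℤ) else -1)| := by
  obtain ⟨⟨y, hy⟩, hsymm, rfl, rfl⟩ := data_affineHom_mul_eq b hη hk g hk' hkg
  exact sum_abs_data_comp_eq_add b hsymm (fun i hi ↦ data_nonneg_of_forall_mem_support b hy hdom hi) g

/-- ★★★ **«`λ(wσ) = λ(σ) - n(w)`» WHEN `σA∘` LIES IN THE NEGATIVE WEYL CHAMBER** (`k_{α_j} ≤ -1` for `j ∈ Δ`), in floor data on `Ŵ_a`: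
`Σ|k' - k∘| = Σ|k - k∘| - Σ|k^w - k∘|`. [cite: IwahoriMatsumoto1965, §1.9 Corollary 1.26 ("λ(w w⁽¹⁾T(d)) = λ(w⁽¹⁾T(d)) − n(w)") and Corollary 1.27] -/
theorem sum_abs_data_affineHom_mul_eq_sub [Nonempty ι] [DecidablePred b.IsPos] {η : ι}
    (hη : ∀ k, P.coroot η - P.coroot k ∈ AddSubmonoid.closure (P.coroot '' (b.support : Set ι))) {w : M ≃ᵃ[K] M} {k : ι → ℤ}
    (hk : w '' {x : M | ∀ i, b.IsPos i → 0 < P.coroot' i x ∧ P.coroot' i x < 1} = alcove P k) (hneg : ∀ j ∈ b.support, k j ≤ -1)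
    (g : P.Aut) {k' kg : ι → ℤ}
    (hk' : ⇑(affineHom P g * w) '' {x : M | ∀ i, b.IsPos i → 0 < P.coroot' i x ∧ P.coroot' i x < 1} = alcove P k')
    (hkg : affineHom P g '' {x : M | ∀ i, b.IsPos i → 0 < P.coroot' i x ∧ P.coroot' i x < 1} = alcove P kg) :
    ∑ i, |k' i - (if b.IsPos i then (0 : ℤ) else -1)| =
      ∑ i, |k i - (if b.IsPos i then (0 : ℤ) else -1)| - ∑ i, |kg i - (if b.IsPos i then (0 : ℤ) else -1)| := by
  obtain ⟨⟨y, hy⟩, hsymm, rfl, rfl⟩ := data_affineHom_mul_eq b hη hk g hk' hkg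
  exact sum_abs_data_comp_eq_sub b hsymm (fun i hi ↦ data_le_neg_one_of_forall_mem_support b hy hneg hi) g

/-- ★★★ **THE SAME FOR THE COXETER LENGTH ON `W_a`: `ℓ(gσ) = ℓ(g) + ℓ(σ)`** for `σ ∈ W_a` with `σA∘` in the positive chamber and every `g ∈ W`
(row g45-#1: `2ℓ = Σ|k - k∘|`). [cite: IwahoriMatsumoto1965, §1.9 Corollaries 1.26, 1.27 and §1.5 Proposition 1.10] [cite: Humphreys1990, §4.5 Theorem] -/
theorem length_affineHom_mul_eq_add_of_forall_nonneg [Nonempty ι] {η : ι}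
    (hη : ∀ k, P.coroot η - P.coroot k ∈ AddSubmonoid.closure (P.coroot '' (b.support : Set ι))) (w : affineWeylGroup P) {k : ι → ℤ}
    (hk : (w : M ≃ᵃ[K] M) '' {x : M | ∀ i, b.IsPos i → 0 < P.coroot' i x ∧ P.coroot' i x < 1} = alcove P k)
    (hdom : ∀ j ∈ b.support, 0 ≤ k j) {g : P.Aut} (hg : g ∈ P.weylGroup) :
    PreCoxeterSystem.length (wallReflection b η) (⟨affineHom P g, affineHom_mem_affineWeylGroup P hg⟩ * w) =
      PreCoxeterSystem.length (wallReflection b η) ⟨affineHom P g, affineHom_mem_affineWeylGroup P hg⟩ +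
        PreCoxeterSystem.length (wallReflection b η) w := by
  classical
  obtain ⟨k', hk', h1⟩ := exists_two_mul_length_affineWeylGroup_eq b hη (⟨affineHom P g, affineHom_mem_affineWeylGroup P hg⟩ * w)
  obtain ⟨kg, hkg, h2⟩ := exists_two_mul_length_affineWeylGroup_eq b hη ⟨affineHom P g, affineHom_mem_affineWeylGroup P hg⟩
  have h3 := two_mul_length_affineWeylGroup_eq b hη w hk
  have h4 := sum_abs_data_affineHom_mul_eq_add b hη hk hdom g hk' hkg
  omega

/-- ★★★ **`ℓ(gσ) + ℓ(g) = ℓ(σ)`** for `σ ∈ W_a` with `σA∘` in the negative chamber and every `g ∈ W`.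
[cite: IwahoriMatsumoto1965, §1.9 Corollaries 1.26, 1.27 and §1.5 Proposition 1.10] [cite: Humphreys1990, §4.5 Theorem] -/
theorem length_affineHom_mul_add_eq_of_forall_le [Nonempty ι] {η : ι}
    (hη : ∀ k, P.coroot η - P.coroot k ∈ AddSubmonoid.closure (P.coroot '' (b.support : Set ι))) (w : affineWeylGroup P) {k : ι → ℤ}
    (hk : (w : M ≃ᵃ[K] M) '' {x : M | ∀ i, b.IsPos i → 0 < P.coroot' i x ∧ P.coroot' i x < 1} = alcove P k)
    (hneg : ∀ j ∈ b.support, k j ≤ -1) {g : P.Aut} (hg : g ∈ P.weylGroup) :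
    PreCoxeterSystem.length (wallReflection b η) (⟨affineHom P g, affineHom_mem_affineWeylGroup P hg⟩ * w) +
      PreCoxeterSystem.length (wallReflection b η) ⟨affineHom P g, affineHom_mem_affineWeylGroup P hg⟩ =
        PreCoxeterSystem.length (wallReflection b η) w := by
  classical
  obtain ⟨k', hk', h1⟩ := exists_two_mul_length_affineWeylGroup_eq b hη (⟨affineHom P g, affineHom_mem_affineWeylGroup P hg⟩ * w)
  obtain ⟨kg, hkg, h2⟩ := exists_two_mul_length_affineWeylGroup_eq b hη ⟨affineHom P g, affineHom_mem_affineWeylGroup P hg⟩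
  have h3 := two_mul_length_affineWeylGroup_eq b hη w hk
  have h4 := sum_abs_data_affineHom_mul_eq_sub b hη hk hneg g hk' hkg
  omega

end Additivity

/-! ## §3 Corollary 1.27: the minimum (maximum) of `ℓ` on the coset `Wσ` -/

section Extremum

/-- ★★ **«`λ(w_iσ) > λ(σ)` iff `P_i ∉ Λ(σ)`»** on `W_a`: for `σA∘ = alcove k` and `j ∈ Δ`, `ℓ(s_{α_j}σ) = ℓ(σ) + 1 ↔ k_{α_j} ≥ 0` and
`ℓ(s_{α_j}σ) + 1 = ℓ(σ) ↔ k_{α_j} ≤ -1` (row g44-#10's count `Σ|k∘s_j - k∘| = Σ|k - k∘| ∓ 2`).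
[cite: IwahoriMatsumoto1965, §1.9 proof of Corollary 1.27 ("λ(w_iσ) > λ(σ) (i = 1, …, l), i.e. P_i ∉ Λ(σ)")] [cite: Humphreys1990, §4.4 Proposition (c)] -/
theorem length_reflection_mul_eq_succ_iff [Nonempty ι] {η : ι}
    (hη : ∀ k, P.coroot η - P.coroot k ∈ AddSubmonoid.closure (P.coroot '' (b.support : Set ι))) (w : affineWeylGroup P) {k : ι → ℤ}
    (hk : (w : M ≃ᵃ[K] M) '' {x : M | ∀ i, b.IsPos i → 0 < P.coroot' i x ∧ P.coroot' i x < 1} = alcove P k) {j : ι} (hj : j ∈ b.support) :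
    (PreCoxeterSystem.length (wallReflection b η) (wallReflection b η (some ⟨j, hj⟩) * w) = PreCoxeterSystem.length (wallReflection b η) w + 1 ↔
        0 ≤ k j) ∧
      (PreCoxeterSystem.length (wallReflection b η) (wallReflection b η (some ⟨j, hj⟩) * w) + 1 = PreCoxeterSystem.length (wallReflection b η) w ↔
        k j ≤ -1) := by
  classical
  obtain ⟨x₀, hx₀⟩ : {x : M | ∀ i, b.IsPos i → 0 < P.coroot' i x ∧ P.coroot' i x < 1}.Nonempty :=
    ⟨_, smul_sum_filter_isPos_mem_fundamentalAlcove b hη⟩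
  have hy : (w : M ≃ᵃ[K] M) x₀ ∈ alcove P k := hk ▸ mem_image_of_mem _ hx₀
  have hk' : ((wallReflection b η (some ⟨j, hj⟩) * w : affineWeylGroup P) : M ≃ᵃ[K] M) ''
      {x : M | ∀ i, b.IsPos i → 0 < P.coroot' i x ∧ P.coroot' i x < 1} = alcove P (fun i ↦ k (P.reflectionPerm j i)) := by
    rw [Subgroup.coe_mul, coe_wallReflection_some, AffineEquiv.coe_mul, image_comp, hk, image_affineHom_reflection_alcove]
  have h1 := two_mul_length_affineWeylGroup_eq b hη w hk
  have h2 := two_mul_length_affineWeylGroup_eq b hη (wallReflection b η (some ⟨j, hj⟩) * w) hk'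
  have h3 := sum_abs_reflection_data_eq_ite b hj (floor_reflectionPerm_self_of_mem_alcove hy j)
  rw [← h1, ← h2] at h3
  constructor
  · constructor
    · intro h; by_contra hlt; rw [if_pos (by omega)] at h3; omega
    · intro h; rw [if_neg (by omega)] at h3; omega
  · constructor
    · intro h; by_contra hlt; rw [if_neg (by omega)] at h3; omega
    · intro h; rw [if_pos h] at h3; omega

/-- ★★★ **IWAHORI–MATSUMOTO COROLLARY 1.27 (MINIMUM)**: for `σ ∈ W_a` with `σA∘ = alcove k`, `Min_{g∈W} ℓ(gσ)` is attained at `g = 1` — i.e.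
`ℓ(σ) ≤ ℓ(gσ)` for all `g ∈ W` — iff `k_{α_j} ≥ 0` for every `j ∈ Δ` (iff `σA∘` lies in the positive Weyl chamber, §1).
[cite: IwahoriMatsumoto1965, §1.9 Corollary 1.27 ("Min λ(wσ) is attained by w = 1 if and only if σD∘ is contained in the positive Weyl chamber")] -/
theorem forall_length_le_length_affineHom_mul_iff [Nonempty ι] {η : ι}
    (hη : ∀ k, P.coroot η - P.coroot k ∈ AddSubmonoid.closure (P.coroot '' (b.support : Set ι))) (w : affineWeylGroup P) {k : ι → ℤ}
    (hk : (w : M ≃ᵃ[K] M) '' {x : M | ∀ i, b.IsPos i → 0 < P.coroot' i x ∧ P.coroot' i x < 1} = alcove P k) :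
    (∀ (g : P.Aut) (hg : g ∈ P.weylGroup), PreCoxeterSystem.length (wallReflection b η) w ≤
        PreCoxeterSystem.length (wallReflection b η) (⟨affineHom P g, affineHom_mem_affineWeylGroup P hg⟩ * w)) ↔
      ∀ j ∈ b.support, 0 ≤ k j := by
  refine ⟨fun h j hj ↦ ?_, fun h g hg ↦ ?_⟩
  · have h1 := h (RootPairing.Equiv.reflection P j) (RootPairing.reflection_mem_weylGroup P j)
    have he : (⟨affineHom P (RootPairing.Equiv.reflection P j), affineHom_mem_affineWeylGroup P (RootPairing.reflection_mem_weylGroup P j)⟩ :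
        affineWeylGroup P) = wallReflection b η (some ⟨j, hj⟩) := Subtype.ext (by rw [coe_wallReflection_some])
    rw [he] at h1
    obtain ⟨-, h2⟩ := length_reflection_mul_eq_succ_iff b hη w hk hj
    by_contra hlt
    have h3 := h2.mpr (by omega)
    omega
  · rw [length_affineHom_mul_eq_add_of_forall_nonneg b hη w hk h hg]
    exact Nat.le_add_left _ _

/-- ★★★ **IWAHORI–MATSUMOTO COROLLARY 1.27 (MAXIMUM)**: `Max_{g∈W} ℓ(gσ)` is attained at `g = 1` — `ℓ(gσ) ≤ ℓ(σ)` for all `g ∈ W` — iff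
`k_{α_j} ≤ -1` for every `j ∈ Δ` (iff `σA∘` lies in the negative Weyl chamber).
[cite: IwahoriMatsumoto1965, §1.9 Corollary 1.27 ("Max λ(wσ) is attained by w = 1 if and only if σD∘ is contained in the negative Weyl chamber")] -/
theorem forall_length_affineHom_mul_le_length_iff [Nonempty ι] {η : ι}
    (hη : ∀ k, P.coroot η - P.coroot k ∈ AddSubmonoid.closure (P.coroot '' (b.support : Set ι))) (w : affineWeylGroup P) {k : ι → ℤ}
    (hk : (w : M ≃ᵃ[K] M) '' {x : M | ∀ i, b.IsPos i → 0 < P.coroot' i x ∧ P.coroot' i x < 1} = alcove P k) :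
    (∀ (g : P.Aut) (hg : g ∈ P.weylGroup),
        PreCoxeterSystem.length (wallReflection b η) (⟨affineHom P g, affineHom_mem_affineWeylGroup P hg⟩ * w) ≤
          PreCoxeterSystem.length (wallReflection b η) w) ↔
      ∀ j ∈ b.support, k j ≤ -1 := by
  refine ⟨fun h j hj ↦ ?_, fun h g hg ↦ ?_⟩
  · have h1 := h (RootPairing.Equiv.reflection P j) (RootPairing.reflection_mem_weylGroup P j)
    have he : (⟨affineHom P (RootPairing.Equiv.reflection P j), affineHom_mem_affineWeylGroup P (RootPairing.reflection_mem_weylGroup P j)⟩ :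
        affineWeylGroup P) = wallReflection b η (some ⟨j, hj⟩) := Subtype.ext (by rw [coe_wallReflection_some])
    rw [he] at h1
    obtain ⟨h2, -⟩ := length_reflection_mul_eq_succ_iff b hη w hk hj
    by_contra hlt
    have h3 := h2.mpr (by omega)
    omega
  · rw [← length_affineHom_mul_add_eq_of_forall_le b hη w hk h hg]
    exact Nat.le_add_right _ _

/-- ★★ **UNIQUENESS OF THE MINIMUM IN `Wσ`** («attained by unique elements»): if `σA∘` lies in the positive chamber and `ℓ(gσ) = ℓ(σ)` for some
`g ∈ W`, then `g = 1` (`ℓ(g) = 0`). [cite: IwahoriMatsumoto1965, §1.9 Corollary 1.26 ("Min λ(w·T(d)) … attained by unique elements") and Corollary 1.27] -/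
theorem eq_one_of_length_affineHom_mul_eq [Nonempty ι] {η : ι}
    (hη : ∀ k, P.coroot η - P.coroot k ∈ AddSubmonoid.closure (P.coroot '' (b.support : Set ι))) (w : affineWeylGroup P) {k : ι → ℤ}
    (hk : (w : M ≃ᵃ[K] M) '' {x : M | ∀ i, b.IsPos i → 0 < P.coroot' i x ∧ P.coroot' i x < 1} = alcove P k)
    (hdom : ∀ j ∈ b.support, 0 ≤ k j) {g : P.Aut} (hg : g ∈ P.weylGroup)
    (h : PreCoxeterSystem.length (wallReflection b η) (⟨affineHom P g, affineHom_mem_affineWeylGroup P hg⟩ * w) =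
      PreCoxeterSystem.length (wallReflection b η) w) : g = 1 := by
  have h1 := length_affineHom_mul_eq_add_of_forall_nonneg b hη w hk hdom hg
  have h2 : PreCoxeterSystem.length (wallReflection b η) (⟨affineHom P g, affineHom_mem_affineWeylGroup P hg⟩ : affineWeylGroup P) = 0 := by
    omega
  have h3 := (isPreCoxeterSystem_affineWeylGroup b hη).length_eq_zero_iff.mp h2
  exact affineHom_injective P (by rw [map_one]; exact congrArg Subtype.val h3)

/-- ★★ **UNIQUENESS OF THE MAXIMUM IN `Wσ`**: if `σA∘` lies in the negative chamber and `ℓ(gσ) = ℓ(σ)` for some `g ∈ W`, then `g = 1`.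
[cite: IwahoriMatsumoto1965, §1.9 Corollary 1.26 ("Max λ(w·T(d)) … attained by unique elements") and Corollary 1.27] -/
theorem eq_one_of_length_affineHom_mul_eq' [Nonempty ι] {η : ι}
    (hη : ∀ k, P.coroot η - P.coroot k ∈ AddSubmonoid.closure (P.coroot '' (b.support : Set ι))) (w : affineWeylGroup P) {k : ι → ℤ}
    (hk : (w : M ≃ᵃ[K] M) '' {x : M | ∀ i, b.IsPos i → 0 < P.coroot' i x ∧ P.coroot' i x < 1} = alcove P k)
    (hneg : ∀ j ∈ b.support, k j ≤ -1) {g : P.Aut} (hg : g ∈ P.weylGroup)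
    (h : PreCoxeterSystem.length (wallReflection b η) (⟨affineHom P g, affineHom_mem_affineWeylGroup P hg⟩ * w) =
      PreCoxeterSystem.length (wallReflection b η) w) : g = 1 := by
  have h1 := length_affineHom_mul_add_eq_of_forall_le b hη w hk hneg hg
  have h2 : PreCoxeterSystem.length (wallReflection b η) (⟨affineHom P g, affineHom_mem_affineWeylGroup P hg⟩ : affineWeylGroup P) = 0 := by
    omega
  have h3 := (isPreCoxeterSystem_affineWeylGroup b hη).length_eq_zero_iff.mp h2
  exact affineHom_injective P (by rw [map_one]; exact congrArg Subtype.val h3)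

end Extremum

end Base

end Literature.LinearAlgebra.RootSystem
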